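import Mathlib
import Literature.Computability.AlgebraicComplexity.MignonRessayreBound
import Literature.Computability.AlgebraicComplexity.LRPencilOfMatrix
import Summits.ValiantsHypothesis.ValiantsHypothesis.Theorems.GrenetZeonTwoDimCoefficientsDefs
import Summits.ValiantsHypothesis.ValiantsHypothesis.Theorems.GrenetZeonTwoDimCoefficientsStubUnitDichotomy
import Summits.ValiantsHypothesis.ValiantsHypothesis.Theorems.GrenetZeonTwoDimCoefficientsPermanentHessianFlat
import Summits.ValiantsHypothesis.ValiantsHypothesis.Theorems.GrenetZeonTwoDimCoefficientsPermanentFlatOrderEval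

/-!
# Crux `GrenetZeon.TwoDimCoefficients` (stmt-ValiantsHypothesis-8062), line `dim2_cases`, stub
# `stub_dualUnipotent`: the FLATNESS rung `2n² ≤ m² + 4n` in the unipotent dual model

The registered stub `stub_dualUnipotent : DualUnipotentBound` asks for `n² ≤ C·m` whenever
`per_n = α·det A + β·tr(adj A · B)` with `A, B` affine `m × m` and `det A ≡ c ≠ 0` — a size lower
bound LINEAR in the number of variables in a model that is pointwise Hessian-blind
(`not_hessianRankBound_unipotentTrace`, `…DualUnipotentHessianBlind.lean`), calibrated
OPEN-PROBLEM GRADE (`Cruxes/TwoDimCoefficients/CALIBRATION-stub_dualUnipotent.md`).  The bounds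
in the tree so far: `n ≤ m` (degree, `le_of_hasDim2Repr`) and `n ≤ 2m` (transfer to `dc`,
`dualUnipotentRepr_linearBound`).

**Theorem (`two_mul_sq_le_of_dualUnipotentRepr`).** `DualUnipotentRepr n m → 2n² ≤ m² + 4n`;
hence `m ≥ √2·n·(1 − o(1))` (`dualUnipotentRepr_seven_mul_le`: `7n ≤ 5m` for `n ≥ 100`).  This is
the first bound in the model that uses the geometry of the permanent rather than degree or
transfer.  Write `A(x) = A₀ + Λ(x)` (`A₀ = A(0)` invertible, `Λ` linear) and `N(x) = A₀⁻¹ Λ(x)`.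

1. FLATNESS (`mkDerivation_mkDerivation_perPoly_eq_zero`, `hess0_perPoly_isOrtho_of_repr`): along a
   direction `v ∈ K := ker Λ` the matrix `A` is constant, so `per_n(x + v) − per_n(x) =
   β·tr(adj A(x) · (B(x+v) − B(x)))` is LINEAR in `v` (`B` affine): `per_n` is affine along every
   coset of `K`, i.e. `K` is totally isotropic for `Hess per_n(p)` at every point `p`.  (Formally:
   the directional derivatives `D_u`, `D_v` (`MvPolynomial.mkDerivation`) kill the entries of `A`,
   hence — being derivations — the entries of `adj A` and `det A`, and `D_u D_v B = 0`.)
2. Hence `dim K ≤ 2n` (`finrank_le_of_hess0_perPoly_isOrtho`, the permanent lemma of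
   `…PermanentHessianFlat.lean`: Hessians of `per_n` at zeroed permutation matrices are polarised
   `2 × 2` permanents).
3. NILPOTENCY (`isNilpotent_pencil`): `det(A₀ + tΛ(x)) = c` for all `t` gives `det(1 + tN(x)) = 1`,
   so `χ_{N(x)} = X^m` and `N(x)` is nilpotent (Cayley–Hamilton); on the linear space `im N` of
   nilpotent matrices the trace form vanishes, `tr(XY) = ½(tr(X+Y)² − tr X² − tr Y²) = 0`
   (`trace_mul_eq_zero_of_isNilpotent`), and `tr(XY)` is non-degenerate on `m × m` matrices (its
   Gram matrix is the permutation matrix of `(a,b) ↦ (b,a)`), so `2·dim im N ≤ m²`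
   (`two_mul_finrank_le_of_isOrtho`).
4. Rank–nullity: `n² = dim K + dim im N ≤ 2n + m²/2`.

HONEST FRAMING: a constant-factor improvement (`1 → √2`) of a LINEAR bound, landed
`--supports stmt-ValiantsHypothesis-8062 --as helper`; the registered stub (a QUADRATIC bound)
stays open-problem grade, and the crux is an ASIDE item far below the quasi-polynomial regime.
`VP ≠ VNP` is not moved by anything here.

References: T. Mignon, N. Ressayre, Int. Math. Res. Not. 2004:79; B. Mathes, M. Omladič, H. Radjavi,
Linear Algebra Appl. 149 (1991) 215–225 (nilpotent spaces); J. M. Landsberg, GCT (2017), §6.4.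
-/

set_option linter.dupNamespace false

noncomputable section

namespace Summit.ValiantsHypothesis.ValiantsHypothesis.Cruxes.TwoDimCoefficients.DimTwoCases

open MvPolynomial Matrix
open Literature.Computability.AlgebraicComplexity

/-! ### Directional derivatives as derivations -/

section DirDeriv

variable {σ : Type*} [Fintype σ]

/-- The second directional derivative of an affine polynomial vanishes. [folklore] -/
theorem mkDerivation_mkDerivation_eq_zero_of_totalDegree_le_one (u v : σ → ℂ)
    {g : MvPolynomial σ ℂ} (hg : g.totalDegree ≤ 1) :
    mkDerivation ℂ (fun s => (C (u s) : MvPolynomial σ ℂ)) (mkDerivation ℂ (fun s => (C (v s) : MvPolynomial σ ℂ)) g) = 0 := by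
  rw [LRPencil.eq_affine_of_totalDegree_le_one g hg]
  simp only [map_add, map_sum, mkDerivation_const_eq_zero (σ := σ), zero_add]
  refine Finset.sum_eq_zero fun w _ => ?_
  rw [Derivation.leibniz, mkDerivation_X, mkDerivation_const_eq_zero, smul_zero, add_zero, smul_eq_mul,
    ← map_mul, mkDerivation_const_eq_zero]

/-- The directional derivative of an affine polynomial is the constant `Σ_w u_w · coeff_{x_w}`.
[folklore] -/
theorem mkDerivation_eq_C_of_totalDegree_le_one (u : σ → ℂ) {g : MvPolynomial σ ℂ}
    (hg : g.totalDegree ≤ 1) :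
    mkDerivation ℂ (fun s => (C (u s) : MvPolynomial σ ℂ)) g = C (∑ w, u w * coeff (Finsupp.single w 1) g) := by
  conv_lhs => rw [LRPencil.eq_affine_of_totalDegree_le_one g hg]
  simp only [map_add, map_sum, mkDerivation_const_eq_zero (σ := σ), zero_add]
  refine Finset.sum_congr rfl fun w _ => ?_
  rw [Derivation.leibniz, mkDerivation_X, mkDerivation_const_eq_zero, smul_zero, add_zero, smul_eq_mul,
    ← map_mul, mul_comm]

omit [Fintype σ] in
/-- A derivation killing every entry of a matrix kills the entries of its adjugate and its
determinant (they are polynomials in the entries). [folklore] -/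
theorem derivation_adjugate_eq_zero {m : ℕ} (D : Derivation ℂ (MvPolynomial σ ℂ) (MvPolynomial σ ℂ))
    (A : Matrix (Fin m) (Fin m) (MvPolynomial σ ℂ)) (hA : ∀ i j, D (A i j) = 0) (i j : Fin m) :
    D (A.adjugate i j) = 0 ∧ D A.det = 0 := by
  classical
  set s : Set (MvPolynomial σ ℂ) := Set.range fun ij : Fin m × Fin m => A ij.1 ij.2 with hs
  have hD : Set.EqOn D (0 : Derivation ℂ (MvPolynomial σ ℂ) (MvPolynomial σ ℂ))
      (Algebra.adjoin ℂ s) := by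
    refine Derivation.eqOn_adjoin ?_
    rintro _ ⟨⟨i', j'⟩, rfl⟩
    exact hA i' j'
  set A' : Matrix (Fin m) (Fin m) (Algebra.adjoin ℂ s) :=
    fun i j => ⟨A i j, Algebra.subset_adjoin ⟨(i, j), rfl⟩⟩ with hA'
  have hAA' : A = (Algebra.adjoin ℂ s).val.toRingHom.mapMatrix A' := by
    ext i' j'; rfl
  constructor
  · have hmem : A.adjugate i j ∈ Algebra.adjoin ℂ s := by
      rw [hAA', ← RingHom.map_adjugate]
      exact (A'.adjugate i j).2
    simpa using hD hmem
  · have hmem : A.det ∈ Algebra.adjoin ℂ s := by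
      rw [hAA', ← RingHom.map_det]
      exact (A'.det).2
    simpa using hD hmem

end DirDeriv

/-! ### Flatness from the representation: `per_n` is affine along `ker(lin A)` -/

section ReprFlat

variable {σ : Type*}

/-- A derivation killing every entry of a matrix kills its determinant. [folklore] -/
theorem derivation_det_eq_zero {m : ℕ} (D : Derivation ℂ (MvPolynomial σ ℂ) (MvPolynomial σ ℂ))
    (A : Matrix (Fin m) (Fin m) (MvPolynomial σ ℂ)) (hA : ∀ i j, D (A i j) = 0) : D A.det = 0 := by
  classical
  set s : Set (MvPolynomial σ ℂ) := Set.range fun ij : Fin m × Fin m => A ij.1 ij.2 with hs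
  have hD : Set.EqOn D (0 : Derivation ℂ (MvPolynomial σ ℂ) (MvPolynomial σ ℂ))
      (Algebra.adjoin ℂ s) := by
    refine Derivation.eqOn_adjoin ?_
    rintro _ ⟨⟨i', j'⟩, rfl⟩
    exact hA i' j'
  set A' : Matrix (Fin m) (Fin m) (Algebra.adjoin ℂ s) :=
    fun i j => ⟨A i j, Algebra.subset_adjoin ⟨(i, j), rfl⟩⟩ with hA'
  have hAA' : A = (Algebra.adjoin ℂ s).val.toRingHom.mapMatrix A' := by
    ext i' j'; rfl
  have hmem : A.det ∈ Algebra.adjoin ℂ s := by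
    rw [hAA', ← RingHom.map_det]
    exact (A'.det).2
  simpa using hD hmem

/-- The Hessian bilinear form at a point is the evaluated second directional derivative:
`uᵀ H(f)(p) v = (D_u D_v f)(p)`. [folklore] -/
theorem toBilin_hess0_transl_eq_eval [Fintype σ] [DecidableEq σ] (p u v : σ → ℂ) (f : MvPolynomial σ ℂ) :
    Matrix.toBilin' (hess0 (transl p f)) u v =
      eval p (mkDerivation ℂ (fun s => (C (u s) : MvPolynomial σ ℂ))
        (mkDerivation ℂ (fun s => (C (v s) : MvPolynomial σ ℂ)) f)) := by
  rw [Matrix.toBilin'_apply, mkDerivation_C_apply_eq_sum, map_sum]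
  refine Finset.sum_congr rfl fun s _ => ?_
  rw [map_mul, eval_C, mkDerivation_C_apply_eq_sum, map_sum, map_sum, Finset.mul_sum]
  refine Finset.sum_congr rfl fun t _ => ?_
  rw [pderiv_C_mul, map_mul, eval_C, hess0_transl]
  ring

variable {n m : ℕ}

/-- **Flatness.** In a representation `per_n = α·det A + β·tr(adj A · B)` with `B` affine, the
permanent is affine along every direction that `A` does not see: if the directional derivatives
`D_u`, `D_v` kill the entries of `A`, then `D_u D_v per_n = 0` (the entries of `adj A` and `det A`
are polynomials in those of `A`, and `D_u D_v B = 0`). [folklore] -/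
theorem mkDerivation_mkDerivation_perPoly_eq_zero (α β : ℂ) (A B : AffMat n m) (hB : IsAffine B)
    (hper : perPoly (Fin n) ℂ = C α * A.det + C β * (A.adjugate * B).trace)
    (u v : Fin n × Fin n → ℂ)
    (hu : ∀ i j, mkDerivation ℂ (fun s => (C (u s) : MvPolynomial (Fin n × Fin n) ℂ)) (A i j) = 0)
    (hv : ∀ i j, mkDerivation ℂ (fun s => (C (v s) : MvPolynomial (Fin n × Fin n) ℂ)) (A i j) = 0) :
    mkDerivation ℂ (fun s => (C (u s) : MvPolynomial (Fin n × Fin n) ℂ))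
      (mkDerivation ℂ (fun s => (C (v s) : MvPolynomial (Fin n × Fin n) ℂ)) (perPoly (Fin n) ℂ))
        = 0 := by
  set Du := mkDerivation ℂ (fun s => (C (u s) : MvPolynomial (Fin n × Fin n) ℂ)) with hDu
  set Dv := mkDerivation ℂ (fun s => (C (v s) : MvPolynomial (Fin n × Fin n) ℂ)) with hDv
  have hvdet : Dv A.det = 0 := derivation_det_eq_zero Dv A hv
  have huadj : ∀ i j, Du (A.adjugate i j) = 0 := fun i j =>
    (derivation_adjugate_eq_zero Du A hu i j).1
  have hvadj : ∀ i j, Dv (A.adjugate i j) = 0 := fun i j =>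
    (derivation_adjugate_eq_zero Dv A hv i j).1
  have huvB : ∀ i j, Du (Dv (B i j)) = 0 := fun i j => by
    rw [hDu, hDv]
    exact mkDerivation_mkDerivation_eq_zero_of_totalDegree_le_one u v (hB i j)
  have hC : ∀ a : ℂ, Dv (C a) = 0 := fun a => by rw [hDv]; exact mkDerivation_const_eq_zero _ a
  have hC' : ∀ a : ℂ, Du (C a) = 0 := fun a => by rw [hDu]; exact mkDerivation_const_eq_zero _ a
  -- first derivative
  have htr : (A.adjugate * B).trace = ∑ i, ∑ j, A.adjugate i j * B j i := by
    simp only [Matrix.trace, Matrix.diag_apply, Matrix.mul_apply]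
  have h1 : Dv (perPoly (Fin n) ℂ) = C β * ∑ i, ∑ j, A.adjugate i j * Dv (B j i) := by
    rw [hper, htr]
    simp only [map_add, map_sum, Derivation.leibniz, hvdet, hC, hvadj, smul_eq_mul, mul_zero,
      add_zero, zero_add]
  -- second derivative
  rw [h1, Derivation.leibniz, hC', smul_zero, add_zero, smul_eq_mul]
  simp only [map_sum, Derivation.leibniz, huvB, huadj, smul_zero, add_zero, Finset.sum_const_zero,
    mul_zero]

/-- **Flatness, Hessian form.** In a representation `per_n = α·det A + β·tr(adj A · B)` with `B`
affine, every subspace of directions not seen by `A` is totally isotropic for the Hessian of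
`per_n` at every point. [folklore] -/
theorem hess0_perPoly_isOrtho_of_repr (α β : ℂ) (A B : AffMat n m) (hB : IsAffine B)
    (hper : perPoly (Fin n) ℂ = C α * A.det + C β * (A.adjugate * B).trace)
    (u v : Fin n × Fin n → ℂ)
    (hu : ∀ i j, mkDerivation ℂ (fun s => (C (u s) : MvPolynomial (Fin n × Fin n) ℂ)) (A i j) = 0)
    (hv : ∀ i j, mkDerivation ℂ (fun s => (C (v s) : MvPolynomial (Fin n × Fin n) ℂ)) (A i j) = 0)
    (p : Fin n × Fin n → ℂ) :
    Matrix.toBilin' (hess0 (transl p (perPoly (Fin n) ℂ))) u v = 0 := by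
  rw [toBilin_hess0_transl_eq_eval, mkDerivation_mkDerivation_perPoly_eq_zero α β A B hB hper u v
    hu hv, map_zero]

end ReprFlat

/-! ### The nilpotent pencil of a unipotent affine matrix is trace-isotropic -/

section Pencil

variable {n m : ℕ}

/-- `det(A₀ + Σ_w x_w A_w) = c` at every point, for an affine matrix with `det A = c`. [folklore] -/
theorem det_constPart_add_eq (A : AffMat n m) (hA : IsAffine A) {c : ℂ} (hdet : A.det = C c)
    (x : Fin n × Fin n → ℂ) : (constPart A + ∑ w, x w • LRPencil.coeffMat A w).det = c := by
  rw [← LRPencil.map_eval_eq A (fun i j => hA i j) x]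
  have h : (A.map (eval x)).det = eval x A.det := by
    rw [RingHom.map_det, RingHom.mapMatrix_apply]
  rw [h, hdet, eval_C]

/-- `det A(0) = c ≠ 0` is a unit. [folklore] -/
theorem isUnit_det_constPart (A : AffMat n m) {c : ℂ} (hc : c ≠ 0) (hdet : A.det = C c) :
    IsUnit (constPart A).det := by rw [det_constPart, hdet, constantCoeff_C]; exact hc.isUnit

/-- **The pencil of a unipotent affine matrix is nilpotent.** If `A` is affine with constant
non-zero determinant, then `A(0)⁻¹ · (A(x) − A(0))` is nilpotent for every `x`:
`det(1 + t N) = 1` for all `t` forces `χ_N = X^m`, then Cayley–Hamilton. [folklore] -/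
theorem isNilpotent_pencil (A : AffMat n m) (hA : IsAffine A) {c : ℂ} (hc : c ≠ 0)
    (hdet : A.det = C c) (x : Fin n × Fin n → ℂ) :
    IsNilpotent ((constPart A)⁻¹ * ∑ w, x w • LRPencil.coeffMat A w) := by
  set A₀ := constPart A with hA₀
  set L := ∑ w, x w • LRPencil.coeffMat A w with hL
  set N := A₀⁻¹ * L with hN
  have hA₀u : IsUnit A₀.det := isUnit_det_constPart A hc hdet
  have hA₀c : A₀.det = c := by rw [hA₀, det_constPart, hdet, constantCoeff_C]
  -- `det (1 + t • N) = 1` for all `t`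
  have h1 : ∀ t : ℂ, (1 + t • N).det = 1 := by
    intro t
    have hLt : ∑ w, (t • x) w • LRPencil.coeffMat A w = t • L := by
      rw [hL, Finset.smul_sum]
      exact Finset.sum_congr rfl fun w _ => by rw [Pi.smul_apply, smul_eq_mul, smul_smul]
    have hdet_t := det_constPart_add_eq A hA hdet (t • x)
    rw [hLt] at hdet_t
    have hmul : A₀ * (1 + t • N) = A₀ + t • L := by
      rw [mul_add, mul_one, Matrix.mul_smul, hN, Matrix.mul_nonsing_inv_cancel_left A₀ L hA₀u]
    have h := congrArg Matrix.det hmul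
    rw [det_mul, hdet_t, hA₀c] at h
    exact mul_left_cancel₀ hc (h.trans (mul_one c).symm)
  -- `χ_N = X^m`
  have hchar : N.charpoly = Polynomial.X ^ m := by
    apply Polynomial.eq_of_infinite_eval_eq
    apply Set.Infinite.mono (s := {t : ℂ | t ≠ 0})
    · intro t ht
      simp only [Set.mem_setOf_eq] at ht ⊢
      rw [Matrix.eval_charpoly, Polynomial.eval_pow, Polynomial.eval_X]
      have hsc : Matrix.scalar (Fin m) t - N = t • (1 + (-t⁻¹) • N) := by
        rw [smul_add, smul_smul, mul_neg, mul_inv_cancel₀ ht, neg_one_smul,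
          Matrix.smul_one_eq_diagonal, ← Matrix.scalar_apply, sub_eq_add_neg]
      rw [hsc, Matrix.det_smul, h1, mul_one, Fintype.card_fin]
    · exact (Set.finite_singleton (0 : ℂ)).infinite_compl
  refine ⟨m, ?_⟩
  have h := Matrix.aeval_self_charpoly N
  rwa [hchar, map_pow, Polynomial.aeval_X] at h

/-- On a linear space of nilpotent matrices the trace form vanishes: `tr(XY) = 0`
(polarise `tr((X+Y)²) = 0`). [folklore] -/
theorem trace_mul_eq_zero_of_isNilpotent (X Y : Matrix (Fin m) (Fin m) ℂ) (hX : IsNilpotent X)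
    (hY : IsNilpotent Y) (hXY : IsNilpotent (X + Y)) : (X * Y).trace = 0 := by
  have h2 : ∀ Z : Matrix (Fin m) (Fin m) ℂ, IsNilpotent Z → (Z * Z).trace = 0 := fun Z hZ =>
    (Matrix.isNilpotent_trace_of_isNilpotent ((Commute.refl Z).isNilpotent_mul_left hZ)).eq_zero
  have h := h2 _ hXY
  rw [add_mul, mul_add, mul_add, trace_add, trace_add, trace_add, h2 X hX, h2 Y hY,
    Matrix.trace_mul_comm Y X] at h
  have h' : (2 : ℂ) * (X * Y).trace = 0 := by linear_combination h
  exact (mul_eq_zero.mp h').resolve_left two_ne_zero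

end Pencil

/-! ### The rung: `2n² ≤ m² + 4n` -/

section Rung

variable {n m : ℕ}

/-- **The flatness rung.** `DualUnipotentRepr n m → 2n² ≤ m² + 4n` (so `m ≥ √2·n·(1 − o(1))`;
previously `m ≥ n` by degree and `n ≤ 2m` by transfer to `dc`).  Write `A(x) = A₀(1 + N(x))`
with `N` linear; (1) `per_n` is affine along `K = ker N` (flatness), so `dim K ≤ 2n` (polarised
`2 × 2` permanents); (2) every `N(x)` is nilpotent (`det A ≡ c`), so the image of `N` is totally
isotropic for the non-degenerate trace form `tr(XY)` on `m × m` matrices, `2·dim im N ≤ m²`;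
(3) rank–nullity: `n² = dim K + dim im N`. [folklore] -/
theorem two_mul_sq_le_of_dualUnipotentRepr (h : DualUnipotentRepr n m) :
    2 * n ^ 2 ≤ m ^ 2 + 4 * n := by
  classical
  obtain ⟨α, β, c, A, B, hA, hB, hc, hdet, hper⟩ := h
  set A₀ := constPart A with hA₀
  have hA₀u : IsUnit A₀.det := isUnit_det_constPart A hc hdet
  -- the linear part `Λ v = Σ_w v_w A_w` and the pencil map `Ψ v = A₀⁻¹ Λ v` (as a vector)
  let Λ : (Fin n × Fin n → ℂ) →ₗ[ℂ] Matrix (Fin m) (Fin m) ℂ :=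
    Fintype.linearCombination ℂ (LRPencil.coeffMat A)
  have hΛ : ∀ v, Λ v = ∑ w, v w • LRPencil.coeffMat A w := fun v =>
    Fintype.linearCombination_apply _ _ _
  let Ψ : (Fin n × Fin n → ℂ) →ₗ[ℂ] (Fin m × Fin m → ℂ) :=
    { toFun := fun v p => (A₀⁻¹ * Λ v) p.1 p.2
      map_add' := fun v w => by
        funext p
        simp only [map_add, Matrix.mul_add, Matrix.add_apply, Pi.add_apply]
      map_smul' := fun a v => by
        funext p
        simp only [map_smul, Matrix.mul_smul, Matrix.smul_apply, Pi.smul_apply, RingHom.id_apply] }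
  have hΨ : ∀ v p, Ψ v p = (A₀⁻¹ * Λ v) p.1 p.2 := fun v p => rfl
  -- (1) the kernel is second-order flat for `per`, hence small
  have hkerΛ : ∀ v ∈ LinearMap.ker Ψ, Λ v = 0 := by
    intro v hv
    rw [LinearMap.mem_ker] at hv
    have h0 : A₀⁻¹ * Λ v = 0 := by
      ext i j
      have := congrFun hv (i, j)
      rwa [hΨ] at this
    rw [← Matrix.mul_nonsing_inv_cancel_left A₀ (Λ v) hA₀u, h0, Matrix.mul_zero]
  have hkerD : ∀ v ∈ LinearMap.ker Ψ, ∀ i j,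
      mkDerivation ℂ (fun s => (C (v s) : MvPolynomial (Fin n × Fin n) ℂ)) (A i j) = 0 := by
    intro v hv i j
    rw [mkDerivation_eq_C_of_totalDegree_le_one v (hA i j)]
    have h := congrFun (congrFun (hkerΛ v hv) i) j
    rw [hΛ, Matrix.sum_apply] at h
    simp only [Matrix.smul_apply, LRPencil.coeffMat_apply, smul_eq_mul, Matrix.zero_apply] at h
    rw [h, C_0]
  have hker : Module.finrank ℂ (LinearMap.ker Ψ) ≤ 2 * n :=
    finrank_le_of_hess0_perPoly_isOrtho _ fun p u hu v hv =>
      hess0_perPoly_isOrtho_of_repr α β A B hB hper u v (hkerD u hu) (hkerD v hv) p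
  -- (2) the range is totally isotropic for the trace form
  set θ : Equiv.Perm (Fin m × Fin m) := Equiv.prodComm (Fin m) (Fin m) with hθ
  set H : Matrix (Fin m × Fin m) (Fin m × Fin m) ℂ := θ.permMatrix ℂ with hH
  have hHdet : H.det ≠ 0 := by
    rw [hH, Matrix.det_permutation]
    exact Int.cast_ne_zero.mpr (Units.ne_zero _)
  have hnil : ∀ v, IsNilpotent (A₀⁻¹ * Λ v) := fun v => by
    rw [hΛ]; exact isNilpotent_pencil A hA hc hdet v
  have hiso : ∀ x ∈ LinearMap.range Ψ, ∀ y ∈ LinearMap.range Ψ, Matrix.toBilin' H x y = 0 := by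
    rintro _ ⟨v, rfl⟩ _ ⟨w, rfl⟩
    rw [Matrix.toBilin'_apply', hH, Matrix.permMatrix_mulVec, dotProduct]
    have htr : (A₀⁻¹ * Λ v * (A₀⁻¹ * Λ w)).trace = 0 := by
      refine trace_mul_eq_zero_of_isNilpotent _ _ (hnil v) (hnil w) ?_
      rw [← Matrix.mul_add, ← map_add]
      exact hnil (v + w)
    rw [← htr, Matrix.trace]
    simp only [Matrix.diag_apply, Matrix.mul_apply, Function.comp_apply, hθ, Equiv.prodComm_apply,
      Prod.swap_prod_mk, hΨ, Fintype.sum_prod_type]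
  have hrange : 2 * Module.finrank ℂ (LinearMap.range Ψ) ≤ m * m := by
    have h := two_mul_finrank_le_of_isOrtho H hHdet (LinearMap.range Ψ) hiso
    rwa [Fintype.card_prod, Fintype.card_fin] at h
  -- (3) rank–nullity
  have hrn := LinearMap.finrank_range_add_finrank_ker Ψ
  rw [Module.finrank_fintype_fun_eq_card, Fintype.card_prod, Fintype.card_fin] at hrn
  nlinarith [hrn, hrange, hker]

/-- **The flatness rung in linear form**: `DualUnipotentRepr n m → 7n ≤ 5m` for `n ≥ 100`. [folklore] -/
theorem dualUnipotentRepr_seven_mul_le (hn : 100 ≤ n) (h : DualUnipotentRepr n m) :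
    7 * n ≤ 5 * m := by
  nlinarith [two_mul_sq_le_of_dualUnipotentRepr h, hn]

end Rung

end Summit.ValiantsHypothesis.ValiantsHypothesis.Cruxes.TwoDimCoefficients.DimTwoCases

end
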